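import Mathlib
import Summits.KontsevichZagierPeriods.KontsevichZagierPeriods.Theorems.SoloInformedLegendreLandenE
import Summits.KontsevichZagierPeriods.KontsevichZagierPeriods.Theorems.SoloInformedDecidedHulls
import HarnessLib
import HarnessLib.Audit

/-!
# SoloInformed — Legendre relation XIII: Landen's transformation of the second kind in `P`

Solo-informed residency (s33), file XIII of the Legendre chain.

THEOREM XX (`soloInformed_landen_second`). For real algebraic `0 < k < 1`, with
`k₁² = 4k/(1+k)²`, in the ring of formal periods `P`:

  `⟦E(k₁)⟧ = ⟦[pt, 2/(1+k)]⟧·⟦E(k)⟧ − ⟦[pt, 1−k]⟧·⟦K(k)⟧`,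

i.e. Landen's transformation of the second kind `E(k₁) = (2E(k) − k'²K(k))/(1+k)` holds by
KZ moves: the Gauss transformation (rule 2, file XII), the exact term `⟦X⟧ = 0` (rule 3, file
XII) and two integrand additivities (rule 1b) expressing the partial-fraction identity
`(1+k)(1−kx²)²/(1+kx²)² + (1−k) = (2/(1+k))(1−k²x²) + (2k/(1+k))·N/(1+kx²)²`.

COROLLARY XX.2 (`soloInformed_ellipticE_sqrtTwoSubOne_complementary`). At the singular modulus
`k₂ = √2 − 1` (where `k₁ = k₂'`): `⟦E'⟧ = ⟦[pt, √2]⟧⟦E⟧ − ⟦[pt, 2 − √2]⟧⟦K⟧` in `P`; with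
COROLLARY XIX.2 (`⟦K'⟧ = ⟦[pt, √2]⟧⟦K⟧`, file XI) and THEOREM XVII this decides KZP on the CM
sector `n = 2` from two generators (file XIV).

References: Landen (1775); Gauss, *Werke* III; Cayley, *Elliptic Functions* ch. XIII;
Whittaker–Watson § 22.42; Borwein–Borwein, *Pi and the AGM* §§ 1.4–1.6, 5.x; this work (s33).
-/

noncomputable section

open MeasureTheory Set Filter
open scoped Classical

open Literature.NumberTheory.Transcendental Literature.NumberTheory.Transcendental.KZ
open Literature.ModelTheory.ExponentialFields

namespace Summit.KontsevichZagierPeriods.KontsevichZagierPeriods.Theorems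

/-- **THEOREM XX (Landen's transformation of the second kind in `P`).** For real algebraic
`0 < k < 1` and representations `K = K(k)`, `E = E(k)`, `E₁ = E(k₁)` on `(0,1)` in Legendre form
(`k₁² = 4k/(1+k)²`):
`⟦E₁⟧ = ⟦[pt, 2/(1+k)]⟧⟦E⟧ − ⟦[pt, 1−k]⟧⟦K⟧`. [Landen 1775; Gauss; this work] -/
theorem soloInformed_landen_second (k : ℝ) (hk : k ∈ Ioo (0:ℝ) 1) (hka : IsAlgebraic ℚ k)
    (K E E₁ : IntegralRep 1)
    (hKd : K.domain = {x : Fin 1 → ℝ | x 0 ∈ Ioo (0:ℝ) 1})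
    (hKi : EqOn K.integrand (fun x => (√(1 - x 0 ^ 2))⁻¹ * (√(1 - k ^ 2 * x 0 ^ 2))⁻¹) K.domain)
    (hEd : E.domain = {x : Fin 1 → ℝ | x 0 ∈ Ioo (0:ℝ) 1})
    (hEi : EqOn E.integrand (fun x => (1 - k ^ 2 * x 0 ^ 2) *
      ((√(1 - x 0 ^ 2))⁻¹ * (√(1 - k ^ 2 * x 0 ^ 2))⁻¹)) E.domain)
    (hE₁d : E₁.domain = {x : Fin 1 → ℝ | x 0 ∈ Ioo (0:ℝ) 1})
    (hE₁i : EqOn E₁.integrand (fun x => (1 - (4 * k / (1 + k) ^ 2) * x 0 ^ 2) *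
      ((√(1 - x 0 ^ 2))⁻¹ * (√(1 - (4 * k / (1 + k) ^ 2) * x 0 ^ 2))⁻¹)) E₁.domain)
    (h2k : IsAlgebraic ℚ (2 / (1 + k))) (h1k : IsAlgebraic ℚ (1 - k)) :
    toFormalPeriod (of E₁) =
      toFormalPeriod (of (IntegralRep.unit.constMul (2 / (1 + k)) h2k)) * toFormalPeriod (of E) -
        toFormalPeriod (of (IntegralRep.unit.constMul (1 - k) h1k)) * toFormalPeriod (of K) := by
  have hsq := BallPeeling.isSemialgebraic_posIoo
  have hmeas : MeasurableSet {x : Fin 1 → ℝ | x 0 ∈ Ioo (0:ℝ) 1} :=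
    (measurable_pi_apply 0) measurableSet_Ioo
  obtain ⟨hk0, hk1⟩ := hk
  have h1kp : 0 < 1 + k := by linarith
  have hden : ∀ x : ℝ, 0 < 1 + k * x ^ 2 := fun x => by nlinarith [sq_nonneg x]
  have hk2a : IsAlgebraic ℚ (k ^ 2) := hka.pow 2
  have hμ : k ^ 2 ∈ Ioo (0:ℝ) 1 := ⟨by positivity, by nlinarith⟩
  have h2kk : IsAlgebraic ℚ (2 * k / (1 + k)) :=
    ((isAlgebraic_nat (R := ℚ) (A := ℝ) 2).mul hka).mul (isAlgebraic_one.add hka).inv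
  -- pointwise facts on `(0,1)`
  have hfacts : ∀ s ∈ Ioo (0:ℝ) 1, 0 < 1 - s ^ 2 ∧ 0 < 1 - k ^ 2 * s ^ 2 ∧ 0 < 1 - k * s ^ 2 :=
    fun s hs => ⟨(soloInformed_legendre_radicand_pos hs (by nlinarith : k ^ 2 < 1)).1,
      (soloInformed_legendre_radicand_pos hs (by nlinarith : k ^ 2 < 1)).2,
      (soloInformed_legendre_radicand_pos hs hk1).2⟩
  -- semialgebraic atoms
  have hq : IsSemialgebraicFunOn ℚ {x : Fin 1 → ℝ | x 0 ∈ Ioo (0:ℝ) 1}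
      (fun x : Fin 1 → ℝ => 1 + k * x 0 ^ 2) :=
    ((isSemialgebraicFunOn_const_of_isAlgebraic hsq isAlgebraic_one).add_holds
      ((isSemialgebraicFunOn_const_of_isAlgebraic hsq hka).mul_holds
        (isSemialgebraicFunOn_aeval hsq (MvPolynomial.X 0 ^ 2)))).congr fun x _ => by
      simp only [Pi.add_apply, Pi.mul_apply, map_pow, MvPolynomial.aeval_X]
  have hκ : IsSemialgebraicFunOn ℚ {x : Fin 1 → ℝ | x 0 ∈ Ioo (0:ℝ) 1}
      (fun x : Fin 1 → ℝ => (√(1 - x 0 ^ 2))⁻¹ * (√(1 - k ^ 2 * x 0 ^ 2))⁻¹) :=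
    soloInformed_sa_arcsine.mul_holds (soloInformed_sa_modulusFactors hμ hk2a).2
  have hlin1 := (soloInformed_sa_modulusFactors ⟨hk0, hk1⟩ hka).1
  have hlin2 := (soloInformed_sa_modulusFactors hμ hk2a).1
  -- reference representations with pointwise integrands
  obtain ⟨K₀, hK₀d, hK₀i⟩ := soloInformed_exists_ellipticK_rep (k ^ 2) hμ hk2a
  obtain ⟨E₀, hE₀d, hE₀i⟩ := soloInformed_exists_ellipticE_rep (k ^ 2) hμ hk2a
  have hK₀int : IntegrableOn (fun x : Fin 1 → ℝ => (√(1 - x 0 ^ 2))⁻¹ * (√(1 - k ^ 2 * x 0 ^ 2))⁻¹)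
      {x : Fin 1 → ℝ | x 0 ∈ Ioo (0:ℝ) 1} := by
    have h := K₀.integrableOn
    rwa [hK₀d, show K₀.integrand = fun x => (√(1 - x 0 ^ 2))⁻¹ * (√(1 - k ^ 2 * x 0 ^ 2))⁻¹ from
      funext hK₀i] at h
  have hE₀int : IntegrableOn (fun x : Fin 1 → ℝ => (1 - k ^ 2 * x 0 ^ 2) *
      ((√(1 - x 0 ^ 2))⁻¹ * (√(1 - k ^ 2 * x 0 ^ 2))⁻¹)) {x : Fin 1 → ℝ | x 0 ∈ Ioo (0:ℝ) 1} := by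
    have h := E₀.integrableOn
    rwa [hE₀d, show E₀.integrand = fun x => (1 - k ^ 2 * x 0 ^ 2) *
      ((√(1 - x 0 ^ 2))⁻¹ * (√(1 - k ^ 2 * x 0 ^ 2))⁻¹) from funext hE₀i] at h
  -- the exact term
  obtain ⟨X, hXd, hXi, hXrel⟩ := soloInformed_landenE_exact k ⟨hk0, hk1⟩ hka
  have hXint : IntegrableOn (fun x : Fin 1 → ℝ => (1 - (2 + k + 2 * k ^ 2) * x 0 ^ 2 +
      3 * k ^ 2 * x 0 ^ 4 + k ^ 3 * x 0 ^ 6) / (√((1 - x 0 ^ 2) * (1 - k ^ 2 * x 0 ^ 2)) *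
      (1 + k * x 0 ^ 2) ^ 2)) {x : Fin 1 → ℝ | x 0 ∈ Ioo (0:ℝ) 1} := by
    have h := X.integrableOn
    rw [hXd] at h
    exact h.congr_fun (by rw [← hXd]; exact hXi) hmeas
  have hXsa : IsSemialgebraicFunOn ℚ {x : Fin 1 → ℝ | x 0 ∈ Ioo (0:ℝ) 1}
      (fun x : Fin 1 → ℝ => (1 - (2 + k + 2 * k ^ 2) * x 0 ^ 2 + 3 * k ^ 2 * x 0 ^ 4 +
        k ^ 3 * x 0 ^ 6) / (√((1 - x 0 ^ 2) * (1 - k ^ 2 * x 0 ^ 2)) * (1 + k * x 0 ^ 2) ^ 2)) := by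
    have h := X.isSemialgebraicFunOn_integrand
    rw [hXd] at h
    exact h.congr (by rw [← hXd]; exact hXi)
  -- the Gauss-transformation source `R`
  obtain ⟨R, hRd, hRi⟩ : ∃ R : IntegralRep 1, R.domain = {x : Fin 1 → ℝ | x 0 ∈ Ioo (0:ℝ) 1} ∧
      ∀ x, R.integrand x = (1 + k) * (1 - k * x 0 ^ 2) ^ 2 / (1 + k * x 0 ^ 2) ^ 2 *
        ((√(1 - x 0 ^ 2))⁻¹ * (√(1 - k ^ 2 * x 0 ^ 2))⁻¹) := by
    have hsa : IsSemialgebraicFunOn ℚ {x : Fin 1 → ℝ | x 0 ∈ Ioo (0:ℝ) 1}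
        (fun x : Fin 1 → ℝ => (1 + k) * (1 - k * x 0 ^ 2) ^ 2 / (1 + k * x 0 ^ 2) ^ 2 *
          ((√(1 - x 0 ^ 2))⁻¹ * (√(1 - k ^ 2 * x 0 ^ 2))⁻¹)) := by
      refine (((((isSemialgebraicFunOn_const_of_isAlgebraic hsq (isAlgebraic_one.add hka)).mul_holds
        (hlin1.mul_holds hlin1)).mul_holds ((hq.mul_holds hq).inv fun x _ => ?_)).mul_holds hκ).congr
        fun x _ => ?_)
      · simp only [Pi.mul_apply]; exact mul_ne_zero (hden _).ne' (hden _).ne'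
      · simp only [Pi.mul_apply, div_eq_mul_inv, sq]
    have hint : IntegrableOn (fun x : Fin 1 → ℝ => (1 + k) * (1 - k * x 0 ^ 2) ^ 2 /
        (1 + k * x 0 ^ 2) ^ 2 * ((√(1 - x 0 ^ 2))⁻¹ * (√(1 - k ^ 2 * x 0 ^ 2))⁻¹))
        {x : Fin 1 → ℝ | x 0 ∈ Ioo (0:ℝ) 1} := by
      refine Integrable.mono' (hK₀int.const_mul (1 + k))
        (by fun_prop : Measurable fun x : Fin 1 → ℝ => (1 + k) * (1 - k * x 0 ^ 2) ^ 2 /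
          (1 + k * x 0 ^ 2) ^ 2 * ((√(1 - x 0 ^ 2))⁻¹ * (√(1 - k ^ 2 * x 0 ^ 2))⁻¹)).aestronglyMeasurable
        ((ae_restrict_iff' hmeas).2 (ae_of_all _ fun x hx => ?_))
      obtain ⟨hw0, hv0, hu0⟩ := hfacts (x 0) hx
      have hd := hden (x 0)
      have hκ0 : 0 < (√(1 - x 0 ^ 2))⁻¹ * (√(1 - k ^ 2 * x 0 ^ 2))⁻¹ :=
        mul_pos (inv_pos.2 (Real.sqrt_pos.2 hw0)) (inv_pos.2 (Real.sqrt_pos.2 hv0))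
      have hratio : (1 - k * x 0 ^ 2) ^ 2 / (1 + k * x 0 ^ 2) ^ 2 ≤ 1 := by
        rw [div_le_one (pow_pos hd 2)]
        nlinarith [mul_pos hk0 (sq_nonneg (x 0) |>.lt_of_ne' (pow_ne_zero 2 hx.1.ne'))]
      rw [Real.norm_eq_abs, abs_of_nonneg (by positivity), mul_div_assoc]
      calc (1 + k) * ((1 - k * x 0 ^ 2) ^ 2 / (1 + k * x 0 ^ 2) ^ 2) *
            ((√(1 - x 0 ^ 2))⁻¹ * (√(1 - k ^ 2 * x 0 ^ 2))⁻¹)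
          ≤ (1 + k) * 1 * ((√(1 - x 0 ^ 2))⁻¹ * (√(1 - k ^ 2 * x 0 ^ 2))⁻¹) := by
            gcongr
        _ = (1 + k) * ((√(1 - x 0 ^ 2))⁻¹ * (√(1 - k ^ 2 * x 0 ^ 2))⁻¹) := by ring
    exact ⟨⟨_, _, hsq, hsa, hint⟩, rfl, fun _ => rfl⟩
  -- the combination `T = (2/(1+k))·E-integrand + (2k/(1+k))·X-integrand`
  obtain ⟨T, hTd, hTi⟩ : ∃ T : IntegralRep 1, T.domain = {x : Fin 1 → ℝ | x 0 ∈ Ioo (0:ℝ) 1} ∧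
      ∀ x, T.integrand x = 2 / (1 + k) * ((1 - k ^ 2 * x 0 ^ 2) *
        ((√(1 - x 0 ^ 2))⁻¹ * (√(1 - k ^ 2 * x 0 ^ 2))⁻¹)) + 2 * k / (1 + k) *
        ((1 - (2 + k + 2 * k ^ 2) * x 0 ^ 2 + 3 * k ^ 2 * x 0 ^ 4 + k ^ 3 * x 0 ^ 6) /
          (√((1 - x 0 ^ 2) * (1 - k ^ 2 * x 0 ^ 2)) * (1 + k * x 0 ^ 2) ^ 2)) := by
    have hsa : IsSemialgebraicFunOn ℚ {x : Fin 1 → ℝ | x 0 ∈ Ioo (0:ℝ) 1}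
        (fun x : Fin 1 → ℝ => 2 / (1 + k) * ((1 - k ^ 2 * x 0 ^ 2) *
        ((√(1 - x 0 ^ 2))⁻¹ * (√(1 - k ^ 2 * x 0 ^ 2))⁻¹)) + 2 * k / (1 + k) *
        ((1 - (2 + k + 2 * k ^ 2) * x 0 ^ 2 + 3 * k ^ 2 * x 0 ^ 4 + k ^ 3 * x 0 ^ 6) /
          (√((1 - x 0 ^ 2) * (1 - k ^ 2 * x 0 ^ 2)) * (1 + k * x 0 ^ 2) ^ 2))) :=
      (((isSemialgebraicFunOn_const_of_isAlgebraic hsq h2k).mul_holds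
        (hlin2.mul_holds hκ)).add_holds
        ((isSemialgebraicFunOn_const_of_isAlgebraic hsq h2kk).mul_holds hXsa)).congr
        fun x _ => by simp only [Pi.add_apply, Pi.mul_apply]
    exact ⟨⟨_, _, hsq, hsa, (hE₀int.const_mul _).add (hXint.const_mul _)⟩, rfl, fun _ => rfl⟩
  -- (m1) the Gauss transformation
  have hm1 : of R - of E₁ ∈ relations := changeOfVariablesRel_subset_relations
    (soloInformed_gauss_transformation_move k ⟨hk0, hk1⟩ hka R E₁ hRd hRi hE₁d hE₁i)
  -- (m2) `T = R + (1−k)·K₀` (rule 1b; the partial-fraction identity)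
  have hm2 : of T - of R - of (K₀.constMul (1 - k) h1k) ∈ relations := by
    refine integrandAddRel_subset_relations ⟨1, T, R, K₀.constMul (1 - k) h1k,
      by rw [hRd, hTd], by rw [IntegralRep.domain_constMul, hK₀d, hTd], fun x hx => ?_, rfl⟩
    rw [hTd] at hx
    obtain ⟨hw0, hv0, hu0⟩ := hfacts (x 0) hx
    have hd := hden (x 0)
    have hw : √(1 - x 0 ^ 2) ≠ 0 := (Real.sqrt_pos.2 hw0).ne'
    have hv : √(1 - k ^ 2 * x 0 ^ 2) ≠ 0 := (Real.sqrt_pos.2 hv0).ne'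
    simp only [Pi.add_apply, hTi, hRi, IntegralRep.integrand_constMul, hK₀i,
      Real.sqrt_mul hw0.le]
    field_simp
    ring
  -- (m3) `T = (2/(1+k))·E + (2k/(1+k))·X` (rule 1b)
  have hm3 : of T - of (E.constMul (2 / (1 + k)) h2k) - of (X.constMul (2 * k / (1 + k)) h2kk) ∈
      relations := by
    refine integrandAddRel_subset_relations ⟨1, T, E.constMul (2 / (1 + k)) h2k,
      X.constMul (2 * k / (1 + k)) h2kk, by rw [IntegralRep.domain_constMul, hEd, hTd],
      by rw [IntegralRep.domain_constMul, hXd, hTd], fun x hx => ?_, rfl⟩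
    rw [hTd] at hx
    have hxE : x ∈ E.domain := by rw [hEd]; exact hx
    have hxX : x ∈ X.domain := by rw [hXd]; exact hx
    simp only [Pi.add_apply, hTi, IntegralRep.integrand_constMul, hEi hxE, hXi hxX]
  -- (m4) `⟦X⟧ = 0`, (m5) `⟦K⟧ = ⟦K₀⟧`
  have hX0 : toFormalPeriod (of X) = 0 := by
    have h : toFormalPeriod (of X) = toFormalPeriod 0 := toFormalPeriod_eq_iff.2 (by simpa using hXrel)
    rw [h, map_zero]
  have hKK : toFormalPeriod (of K) = toFormalPeriod (of K₀) :=
    toFormalPeriod_eq_iff.2 (of_sub_of_mem_relations_of_eqOn (by rw [hK₀d, hKd])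
      fun x hx => by rw [hKi hx, hK₀i])
  -- assembly in `P`
  have e1 : toFormalPeriod (of E₁) = toFormalPeriod (of R) :=
    (toFormalPeriod_eq_iff.2 hm1).symm
  have e2 : toFormalPeriod (of T) = toFormalPeriod (of R) +
      toFormalPeriod (of (K₀.constMul (1 - k) h1k)) := by
    have h := toFormalPeriod_eq_iff.2 (show of T - (of R + of (K₀.constMul (1 - k) h1k)) ∈ relations by
      have e : of T - (of R + of (K₀.constMul (1 - k) h1k)) =
        of T - of R - of (K₀.constMul (1 - k) h1k) := by abel
      rw [e]; exact hm2)
    rw [h, map_add]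
  have e3 : toFormalPeriod (of T) = toFormalPeriod (of (E.constMul (2 / (1 + k)) h2k)) +
      toFormalPeriod (of (X.constMul (2 * k / (1 + k)) h2kk)) := by
    have h := toFormalPeriod_eq_iff.2 (show of T - (of (E.constMul (2 / (1 + k)) h2k) +
        of (X.constMul (2 * k / (1 + k)) h2kk)) ∈ relations by
      have e : of T - (of (E.constMul (2 / (1 + k)) h2k) + of (X.constMul (2 * k / (1 + k)) h2kk)) =
        of T - of (E.constMul (2 / (1 + k)) h2k) - of (X.constMul (2 * k / (1 + k)) h2kk) := by abel
      rw [e]; exact hm3)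
    rw [h, map_add]
  rw [toFormalPeriod_of_constMul (2 / (1 + k)) h2k E, toFormalPeriod_of_constMul (2 * k / (1 + k)) h2kk X,
    hX0, mul_zero, add_zero] at e3
  rw [toFormalPeriod_of_constMul (1 - k) h1k K₀, ← hKK] at e2
  rw [e1]
  linear_combination e3 - e2

/-- THEOREM XX in values: `E(k₁) = (2/(1+k))·E(k) − (1−k)·K(k)`, `k₁² = 4k/(1+k)²`.
[Landen 1775; this work] -/
theorem soloInformed_landen_second_value (k : ℝ) (hk : k ∈ Ioo (0:ℝ) 1) (hka : IsAlgebraic ℚ k)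
    (K E E₁ : IntegralRep 1)
    (hKd : K.domain = {x : Fin 1 → ℝ | x 0 ∈ Ioo (0:ℝ) 1})
    (hKi : EqOn K.integrand (fun x => (√(1 - x 0 ^ 2))⁻¹ * (√(1 - k ^ 2 * x 0 ^ 2))⁻¹) K.domain)
    (hEd : E.domain = {x : Fin 1 → ℝ | x 0 ∈ Ioo (0:ℝ) 1})
    (hEi : EqOn E.integrand (fun x => (1 - k ^ 2 * x 0 ^ 2) *
      ((√(1 - x 0 ^ 2))⁻¹ * (√(1 - k ^ 2 * x 0 ^ 2))⁻¹)) E.domain)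
    (hE₁d : E₁.domain = {x : Fin 1 → ℝ | x 0 ∈ Ioo (0:ℝ) 1})
    (hE₁i : EqOn E₁.integrand (fun x => (1 - (4 * k / (1 + k) ^ 2) * x 0 ^ 2) *
      ((√(1 - x 0 ^ 2))⁻¹ * (√(1 - (4 * k / (1 + k) ^ 2) * x 0 ^ 2))⁻¹)) E₁.domain) :
    E₁.value = 2 / (1 + k) * E.value - (1 - k) * K.value := by
  have h2k : IsAlgebraic ℚ (2 / (1 + k)) :=
    (isAlgebraic_nat (R := ℚ) (A := ℝ) 2).mul (isAlgebraic_one.add hka).inv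
  have h1k : IsAlgebraic ℚ (1 - k) := isAlgebraic_one.sub hka
  have h := congrArg evalP (soloInformed_landen_second k hk hka K E E₁ hKd hKi hEd hEi hE₁d hE₁i
    h2k h1k)
  simpa [evalP_toFormalPeriod, map_mul, map_sub, IntegralRep.value_constMul] using h

/-- **COROLLARY XX.2 (the second-kind CM relation at `k₂ = √2 − 1`, in `P`).** With
`k = √2 − 1` one has `k₁² = 4k/(1+k)² = 1 − k²`, `2/(1+k) = √2`, `1 − k = 2 − √2`; hence for
representations `K = K(k₂)`, `E = E(k₂)`, `E' = E(k₂')` on `(0,1)`: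
`⟦E'⟧ = ⟦[pt, √2]⟧⟦E⟧ − ⟦[pt, 2 − √2]⟧⟦K⟧`. [this work; classical in values] -/
theorem soloInformed_ellipticE_sqrtTwoSubOne_complementary (K E E' : IntegralRep 1)
    (hKd : K.domain = {x : Fin 1 → ℝ | x 0 ∈ Ioo (0:ℝ) 1})
    (hKi : EqOn K.integrand (fun x => (√(1 - x 0 ^ 2))⁻¹ *
      (√(1 - (√2 - 1) ^ 2 * x 0 ^ 2))⁻¹) K.domain)
    (hEd : E.domain = {x : Fin 1 → ℝ | x 0 ∈ Ioo (0:ℝ) 1})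
    (hEi : EqOn E.integrand (fun x => (1 - (√2 - 1) ^ 2 * x 0 ^ 2) *
      ((√(1 - x 0 ^ 2))⁻¹ * (√(1 - (√2 - 1) ^ 2 * x 0 ^ 2))⁻¹)) E.domain)
    (hE'd : E'.domain = {x : Fin 1 → ℝ | x 0 ∈ Ioo (0:ℝ) 1})
    (hE'i : EqOn E'.integrand (fun x => (1 - (1 - (√2 - 1) ^ 2) * x 0 ^ 2) *
      ((√(1 - x 0 ^ 2))⁻¹ * (√(1 - (1 - (√2 - 1) ^ 2) * x 0 ^ 2))⁻¹)) E'.domain)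
    (h2 : IsAlgebraic ℚ (√2 : ℝ)) (h22 : IsAlgebraic ℚ (2 - √2 : ℝ)) :
    toFormalPeriod (of E') =
      toFormalPeriod (of (IntegralRep.unit.constMul (√2) h2)) * toFormalPeriod (of E) -
        toFormalPeriod (of (IntegralRep.unit.constMul (2 - √2) h22)) * toFormalPeriod (of K) := by
  have hs2 : (√2 : ℝ) ^ 2 = 2 := Real.sq_sqrt (by norm_num)
  have hs2p : (1:ℝ) < √2 := by
    rw [show (1:ℝ) = √1 from Real.sqrt_one.symm]
    exact Real.sqrt_lt_sqrt (by norm_num) (by norm_num)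
  have hs2l : (√2 : ℝ) < 2 := by
    nlinarith [Real.sqrt_nonneg 2]
  set k : ℝ := √2 - 1 with hkdef
  have hk : k ∈ Ioo (0:ℝ) 1 := ⟨by rw [hkdef]; linarith, by rw [hkdef]; linarith⟩
  have hka : IsAlgebraic ℚ k := h2.sub isAlgebraic_one
  have h1kp : (1 + k) = √2 := by rw [hkdef]; ring
  have hmod : 4 * k / (1 + k) ^ 2 = 1 - k ^ 2 := by
    rw [h1kp, hs2, hkdef]
    nlinarith [hs2]
  have h2k' : 2 / (1 + k) = √2 := by
    rw [h1kp, div_eq_iff (by positivity)]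
    linear_combination hs2.symm
  have h1k' : 1 - k = 2 - √2 := by rw [hkdef]; ring
  have h2k : IsAlgebraic ℚ (2 / (1 + k)) := by rw [h2k']; exact h2
  have h1k : IsAlgebraic ℚ (1 - k) := by rw [h1k']; exact h22
  have hmain := soloInformed_landen_second k hk hka K E E' hKd hKi hEd hEi hE'd
    (by rw [hmod]; exact hE'i) h2k h1k
  rw [hmain, soloInformed_pointRep_congr h2k h2 h2k', soloInformed_pointRep_congr h1k h22 h1k']

/-- COROLLARY XX.2 in values: `E(k₂') = √2·E(k₂) − (2 − √2)·K(k₂)`, `k₂ = √2 − 1`.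
[classical; this work] -/
theorem soloInformed_ellipticE_sqrtTwoSubOne_complementary_value (K E E' : IntegralRep 1)
    (hKd : K.domain = {x : Fin 1 → ℝ | x 0 ∈ Ioo (0:ℝ) 1})
    (hKi : EqOn K.integrand (fun x => (√(1 - x 0 ^ 2))⁻¹ *
      (√(1 - (√2 - 1) ^ 2 * x 0 ^ 2))⁻¹) K.domain)
    (hEd : E.domain = {x : Fin 1 → ℝ | x 0 ∈ Ioo (0:ℝ) 1})
    (hEi : EqOn E.integrand (fun x => (1 - (√2 - 1) ^ 2 * x 0 ^ 2) *
      ((√(1 - x 0 ^ 2))⁻¹ * (√(1 - (√2 - 1) ^ 2 * x 0 ^ 2))⁻¹)) E.domain)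
    (hE'd : E'.domain = {x : Fin 1 → ℝ | x 0 ∈ Ioo (0:ℝ) 1})
    (hE'i : EqOn E'.integrand (fun x => (1 - (1 - (√2 - 1) ^ 2) * x 0 ^ 2) *
      ((√(1 - x 0 ^ 2))⁻¹ * (√(1 - (1 - (√2 - 1) ^ 2) * x 0 ^ 2))⁻¹)) E'.domain) :
    E'.value = √2 * E.value - (2 - √2) * K.value := by
  have h2 : IsAlgebraic ℚ (√2 : ℝ) := ⟨Polynomial.X ^ 2 - Polynomial.C 2,
    (Polynomial.monic_X_pow_sub_C (2 : ℚ) two_ne_zero).ne_zero, by simp [Real.sq_sqrt]⟩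
  have h22 : IsAlgebraic ℚ (2 - √2 : ℝ) := (isAlgebraic_nat (R := ℚ) (A := ℝ) 2).sub h2
  have h := congrArg evalP (soloInformed_ellipticE_sqrtTwoSubOne_complementary K E E' hKd hKi hEd
    hEi hE'd hE'i h2 h22)
  simpa [evalP_toFormalPeriod, map_mul, map_sub, IntegralRep.value_constMul] using h

end Summit.KontsevichZagierPeriods.KontsevichZagierPeriods.Theorems

end
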